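import Summits.CriticalPhenomena.PercolationContinuityZ3.Theorems.PercNearOneGluingNoHeavyLowerTailSahiWidthPhaseDiagram

/-!
# `NoHeavyLowerTail` (crux stmt-CriticalPhenomena-4575), Sahi programme P1: PARAMETRISED LAYERS of Sahi's conjecture —
# `P_T(d,n) ⟺ W_T(d,n) ⟺ U_T(d,n)` for a finite distributive parameter lattice `T`

Support file (Sahi cell, seat `prim-sahi-p1`, generation 5; `--supports stmt-CriticalPhenomena-4575`).  Pure proofs, no
definitions, standard axioms.

`…SahiWidthStratification` / `…SahiUniformGrid` organised Sahi's Conjecture 5 (= Lieb–Sahi's Conjecture 1.1) by WIDTH =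
DIMENSION: for each `d, n`, `U(d,n) ⟺ P(d,n) ⟺ W(d,n)`.  The parametrised Rosenblatt coupling `SahiWidth.exists_gridCoupling`
behind it already carries a finite distributive PARAMETER lattice `T`; this file records the resulting finer equivalences,
for every `T`, `d`, `n`:

* `param_grid_iff_fkg T d n`: [`P_T(d,n)`: every weight `ν ⊗ g_1 ⊗ ⋯ ⊗ g_d` on `T × [K+1]^d` with `ν` an FKG probability
  weight on `T` and `g_i` probability weights on the chain satisfies Sahi's `E_n ≥ 0`] ⟺ [`W_T(d,n)`: every FKG probability
  weight on every `T × [b+1]^d` does] (the `T`-marginal of an FKG weight is FKG by Karlin–Rinott, and the weight is a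
  monotone image of `marginal ⊗ (grid gaps)^{⊗d}`);
* `param_grid_iff_uniform T d n`: `P_T(d,n) ⟺` [`U_T(d,n)`: every `ν ⊗ (uniform weight on [M]^d)`, `ν` FKG on `T`, `M ≥ 1`,
  does] (block maps with a passive parameter + continuity of `E_n` in the weight); `param_fkg_iff_uniform`.
* `sahiPositive_of_latticeEmbedding_order`: Sahi positivity AT A FIXED ORDER passes to sublattices (the all-orders version
  is `sahiPositive_of_latticeEmbedding`).

`T` a point recovers the width stratification; `T = Fin 2`, `d = 2` is the TWO-LAYER class of `…SahiTwoLayer`, which contains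
all the smallest open lattices of the programme except `2⁴`.  New mathematics (the organisation), standard ingredients.
-/


namespace Summit.CriticalPhenomena.PercolationContinuityZ3.Theorems.SahiLayer

open Finset Function Filter Topology Literature.Combinatorics.Sahi2008 ProductChains SahiWidth SahiTwoDim SahiThreeDim
open scoped BigOperators

noncomputable section

universe u

/-! ## Products of FKG weights -/

section FKGProd

variable {α β : Type*} [Fintype α] [Fintype β] [Lattice α] [Lattice β]

/-- The product of two FKG probability weights is an FKG probability weight on the product lattice. [folklore] -/
theorem isFKGMeasure_prod {ν : α → ℝ} {ρ : β → ℝ} (hν : IsFKGMeasure ν) (hρ : IsFKGMeasure ρ) :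
    IsFKGMeasure (fun x : α × β => ν x.1 * ρ x.2) := by
  refine ⟨fun x => mul_nonneg (hν.nonneg _) (hρ.nonneg _), ?_, fun x y => ?_⟩
  · rw [Fintype.sum_prod_type]
    simp_rw [← Finset.mul_sum, hρ.sum_eq_one, mul_one]
    exact hν.sum_eq_one
  · have h1 := hν.mul_le_mul x.1 y.1
    have h2 := hρ.mul_le_mul x.2 y.2
    simp only [Prod.fst_inf, Prod.snd_inf, Prod.fst_sup, Prod.snd_sup]
    calc ν x.1 * ρ x.2 * (ν y.1 * ρ y.2) = (ν x.1 * ν y.1) * (ρ x.2 * ρ y.2) := by ring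
      _ ≤ (ν (x.1 ⊓ y.1) * ν (x.1 ⊔ y.1)) * (ρ (x.2 ⊓ y.2) * ρ (x.2 ⊔ y.2)) :=
          mul_le_mul h1 h2 (mul_nonneg (hρ.nonneg _) (hρ.nonneg _)) (mul_nonneg (hν.nonneg _) (hν.nonneg _))
      _ = _ := by ring

/-- Every probability weight on a finite chain is an FKG probability weight (the lattice condition holds with equality).
[folklore] -/
theorem isFKGMeasure_of_linearOrder {σ : Type*} [Fintype σ] [LinearOrder σ] {ν : σ → ℝ} (h0 : ∀ t, 0 ≤ ν t)
    (h1 : ∑ t, ν t = 1) : IsFKGMeasure ν :=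
  ⟨h0, h1, fun x y => (mul_inf_sup_eq ν x y).symm.le⟩

end FKGProd

/-! ## Parametrised layers: `P_T(d,n) ⟺ W_T(d,n) ⟺ U_T(d,n)` -/

section Param

variable {T : Type u} [DistribLattice T] [Fintype T] {d n : ℕ}

/-- The parametrised product weight `ν ⊗ g_1 ⊗ ⋯ ⊗ g_d` on `T × [K+1]^d` is an FKG probability weight. [folklore] -/
theorem isFKGMeasure_paramGridProd {K : ℕ} {ν : T → ℝ} (hν : IsFKGMeasure ν) (g : Fin d → Fin (K + 1) → ℝ)
    (hg0 : ∀ i u, 0 ≤ g i u) (hg1 : ∀ i, ∑ u, g i u = 1) :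
    IsFKGMeasure (fun x : T × (Fin d → Fin (K + 1)) => ν x.1 * ∏ i, g i (x.2 i)) :=
  isFKGMeasure_prod hν (isFKGMeasure_gridProd g hg0 hg1)

omit [DistribLattice T] in
/-- The `T`-marginal of a weight on `T × X`, as a push-forward along the first projection. [folklore] -/
theorem pushWeight_fst_eq {X : Type*} [Fintype X] (μ : T × X → ℝ) :
    pushWeight μ Prod.fst = fun t : T => ∑ m, μ (t, m) := by
  classical
  funext t
  rw [pushWeight_apply, Fintype.sum_prod_type, Finset.sum_eq_single t]
  · exact sum_congr rfl fun m _ => if_pos rfl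
  · intro t' _ ht'
    exact sum_eq_zero fun m _ => if_neg ht'
  · exact fun h => (h (mem_univ _)).elim

/-- **`P_T(d,n) ⇒ W_T(d,n)`** (parametrised Rosenblatt coupling): if every weight `ν_T ⊗ g^{⊗ d}` on `T × [K+1]^d` with
`ν_T` FKG on the parameter lattice `T` satisfies Sahi's `E_n ≥ 0`, then so does every FKG probability weight on every
`T × [b+1]^d` — it is a MONOTONE image of such a weight (`SahiWidth.exists_gridCoupling`), with `ν_T` its `T`-marginal
(FKG by Karlin–Rinott). [this work] -/
theorem sahiPositive_of_isFKGMeasure_paramGrid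
    (H : ∀ (K : ℕ) (ν : T → ℝ), IsFKGMeasure ν → ∀ (g : Fin d → Fin (K + 1) → ℝ), (∀ i u, 0 ≤ g i u) →
      (∀ i, ∑ u, g i u = 1) → SahiPositive (fun x : T × (Fin d → Fin (K + 1)) => ν x.1 * ∏ i, g i (x.2 i)) n)
    {b : ℕ} {μ : T × (Fin d → Fin (b + 1)) → ℝ} (hμ : IsFKGMeasure μ) : SahiPositive μ n := by
  classical
  obtain ⟨C₀, hC₀01, hcoup⟩ := exists_gridCoupling d b μ hμ
  -- a grid through `C₀ ∪ {0, 1}`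
  obtain ⟨C, hC⟩ : ∃ C : Finset ℝ, C = insert 0 (insert 1 C₀) := ⟨_, rfl⟩
  have h0C : (0 : ℝ) ∈ C := by rw [hC]; exact mem_insert_self _ _
  have h1C : (1 : ℝ) ∈ C := by rw [hC]; exact mem_insert_of_mem (mem_insert_self _ _)
  have hCb : ∀ c ∈ C, 0 ≤ c ∧ c ≤ 1 := by
    intro c hc
    rw [hC, mem_insert, mem_insert] at hc
    rcases hc with rfl | rfl | hc
    · exact ⟨le_rfl, zero_le_one⟩
    · exact ⟨zero_le_one, le_rfl⟩
    · exact hC₀01 c hc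
  have hcard : 2 ≤ C.card := by
    have : ({0, 1} : Finset ℝ) ⊆ C := by
      intro c hc
      simp only [mem_insert, mem_singleton] at hc
      rcases hc with rfl | rfl
      · exact h0C
      · exact h1C
    calc 2 = ({0, 1} : Finset ℝ).card := by rw [card_pair zero_ne_one]
      _ ≤ C.card := card_le_card this
  obtain ⟨K, hK⟩ : ∃ K, C.card = (K + 1) + 1 := ⟨C.card - 2, by omega⟩
  obtain ⟨γ, hγdef⟩ : ∃ γ : Fin (K + 1 + 1) → ℝ, γ = fun v => C.orderEmbOfFin hK v := ⟨_, rfl⟩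
  have hγ : StrictMono γ := by rw [hγdef]; exact (C.orderEmbOfFin hK).strictMono
  have hγ0 : γ 0 = 0 := by
    rw [hγdef]
    show C.orderEmbOfFin hK ⟨0, by omega⟩ = 0
    rw [orderEmbOfFin_zero hK (by omega)]
    exact le_antisymm (min'_le _ _ h0C) ((hCb _ (min'_mem _ _)).1)
  have hγ1 : γ (Fin.last (K + 1)) = 1 := by
    rw [hγdef]
    show C.orderEmbOfFin hK ⟨K + 1, by omega⟩ = 1
    have h := orderEmbOfFin_last hK (by omega)
    simp only [Nat.add_sub_cancel] at h
    rw [h]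
    exact le_antisymm ((hCb _ (max'_mem _ _)).2) (le_max' _ _ h1C)
  have hγC : ∀ c ∈ C₀, ∃ v, γ v = c := by
    intro c hc
    have h : c ∈ Set.range (C.orderEmbOfFin hK) := by
      rw [range_orderEmbOfFin, hC]; exact mem_insert_of_mem (mem_insert_of_mem hc)
    obtain ⟨v, hv⟩ := h
    exact ⟨v, by rw [hγdef]; exact hv⟩
  obtain ⟨G, hGmono, hGpush⟩ := hcoup (K + 1) γ (fun u => γ u.succ - γ (Fin.castSucc u)) hγ hγ0 hγ1 (fun u => rfl) hγC
  have hg0 : ∀ u : Fin (K + 1), 0 ≤ γ u.succ - γ (Fin.castSucc u) :=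
    fun u => sub_nonneg.2 (hγ.monotone (Fin.castSucc_le_succ u))
  have hg1 : ∑ u : Fin (K + 1), (γ u.succ - γ (Fin.castSucc u)) = 1 := sum_gaps_univ γ hγ0 hγ1
  -- the `T`-marginal is an FKG probability weight on `T` (Karlin–Rinott)
  have hνT : IsFKGMeasure (fun t : T => ∑ m, μ (t, m)) := by
    have h := hμ.pushWeight_fst
    rwa [pushWeight_fst_eq] at h
  have hsrc : SahiPositive (fun x : T × (Fin d → Fin (K + 1)) =>
      (∑ m, μ (x.1, m)) * ∏ i, (γ (x.2 i).succ - γ (Fin.castSucc (x.2 i)))) n :=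
    H K _ hνT (fun _ u => γ u.succ - γ (Fin.castSucc u)) (fun _ u => hg0 u) (fun _ => hg1)
  rw [← hGpush]
  exact SahiPositive.of_pushWeight hsrc hGmono

variable (T) in
/-- **PARAMETRISED LAYERS: `P_T(d,n) ⟺ W_T(d,n)`.**  For a finite distributive parameter lattice `T`, Sahi's `E_n ≥ 0`
for every weight `ν ⊗ g_1 ⊗ ⋯ ⊗ g_d` on `T × [K+1]^d` (`ν` FKG on `T`, `g_i` probability weights on the chain) is equivalent
to `E_n ≥ 0` for every FKG probability weight on every `T × [b+1]^d`.  (`T = PUnit`: the width stratification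
`SahiWidth.liebSahi_grid_iff_fkg_grid`.) [this work] -/
theorem param_grid_iff_fkg (d n : ℕ) :
    (∀ (K : ℕ) (ν : T → ℝ), IsFKGMeasure ν → ∀ (g : Fin d → Fin (K + 1) → ℝ), (∀ i u, 0 ≤ g i u) →
      (∀ i, ∑ u, g i u = 1) → SahiPositive (fun x : T × (Fin d → Fin (K + 1)) => ν x.1 * ∏ i, g i (x.2 i)) n) ↔
    ∀ (b : ℕ) (μ : T × (Fin d → Fin (b + 1)) → ℝ), IsFKGMeasure μ → SahiPositive μ n :=
  ⟨fun H _ _ hμ => sahiPositive_of_isFKGMeasure_paramGrid H hμ,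
    fun H K _ hν g hg0 hg1 => H K _ (isFKGMeasure_paramGridProd hν g hg0 hg1)⟩

/-! ### The uniform form with a parameter -/

omit [DistribLattice T] in
/-- Push-forward of `ν ⊗ w` along `id × G` is `ν ⊗ G_* w`. [folklore] -/
theorem pushWeight_id_prodMap {X Y : Type*} [Fintype X] [Fintype Y] [DecidableEq Y] [DecidableEq T]
    (ν : T → ℝ) (w : X → ℝ) (G : X → Y) :
    pushWeight (fun x : T × X => ν x.1 * w x.2) (fun x => (x.1, G x.2)) = fun y : T × Y => ν y.1 * pushWeight w G y.2 := by
  classical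
  funext ⟨t, y⟩
  rw [pushWeight_apply, pushWeight_apply, Fintype.sum_prod_type, mul_sum]
  rw [Finset.sum_eq_single t]
  · refine sum_congr rfl fun x _ => ?_
    by_cases h : G x = y
    · rw [if_pos (by rw [h]), if_pos h]
    · rw [if_neg (fun h' => h (Prod.mk.inj h').2), if_neg h, mul_zero]
  · intro t' _ ht'
    exact sum_eq_zero fun x _ => if_neg fun h' => ht' (Prod.mk.inj h').1
  · exact fun h => (h (mem_univ _)).elim

omit [DistribLattice T] in
/-- **Block maps with a passive parameter**: `ν ⊗ (uniform on [M]^d)` pushes forward to `ν ⊗ ∏_i k_i(u_i)/M` along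
`id × (coordinatewise block map)`. [cite: LiebSahi2021, Lemma 2.3 (§2)] -/
theorem pushWeight_param_uniform_blockMapPi [DecidableEq T] {K M : ℕ} (ν : T → ℝ) (k : Fin d → Fin (K + 1) → ℕ)
    (hk : ∀ i, ∑ v, k i v = M) :
    pushWeight (fun x : T × (Fin d → Fin M) => ν x.1 * ((1 : ℝ) / (M : ℝ) ^ d))
        (fun x => (x.1, fun i => blockMap (k i) (hk i) (x.2 i))) =
      fun y : T × (Fin d → Fin (K + 1)) => ν y.1 * ∏ i, ((k i (y.2 i) : ℝ) / M) := by
  classical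
  rw [pushWeight_id_prodMap ν (fun _ : Fin d → Fin M => (1 : ℝ) / (M : ℝ) ^ d)
    (fun ω i => blockMap (k i) (hk i) (ω i)), pushWeight_uniform_blockMapPi k hk]

/-- **`U_T(d,n) ⇒ P_T(d,n)`, rational weights**: under `U_T(d,n)`, every `ν ⊗ ∏_i k_i(u_i)/M` (compositions `k_i` of
`M ≥ 1`) satisfies Sahi's `E_n ≥ 0`. [this work] -/
theorem sahiPositive_paramGridProd_rat [DecidableEq T] {K M : ℕ}
    (hU : ∀ (ν : T → ℝ), IsFKGMeasure ν → ∀ M, 0 < M →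
      SahiPositive (fun x : T × (Fin d → Fin M) => ν x.1 * ((1 : ℝ) / (M : ℝ) ^ d)) n)
    {ν : T → ℝ} (hν : IsFKGMeasure ν) (k : Fin d → Fin (K + 1) → ℕ) (hM : 0 < M) (hk : ∀ i, ∑ v, k i v = M) :
    SahiPositive (fun y : T × (Fin d → Fin (K + 1)) => ν y.1 * ∏ i, ((k i (y.2 i) : ℝ) / M)) n := by
  rw [← pushWeight_param_uniform_blockMapPi ν k hk]
  exact (hU ν hν M hM).of_pushWeight fun x x' h => ⟨h.1, fun i => blockMap_mono (k i) (hk i) (h.2 i)⟩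

omit [DistribLattice T] [Fintype T] in
/-- The parametrised grid product weight is continuous in the family of coordinate weights. [folklore] -/
theorem continuous_paramGridProd {K : ℕ} (ν : T → ℝ) :
    Continuous fun v : Fin d → Fin (K + 1) → ℝ => fun x : T × (Fin d → Fin (K + 1)) => ν x.1 * ∏ i, v i (x.2 i) :=
  continuous_pi fun x => continuous_const.mul
    (continuous_finsetProd _ fun i _ => (continuous_apply (x.2 i)).comp (continuous_apply i))

/-- **`U_T(d,n) ⇒ P_T(d,n)`**: rational coordinate weights by block maps, the rest by continuity of `E_n` in the weight.
[this work] -/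
theorem sahiPositive_paramGridProd_of_uniform [DecidableEq T]
    (hU : ∀ (ν : T → ℝ), IsFKGMeasure ν → ∀ M, 0 < M →
      SahiPositive (fun x : T × (Fin d → Fin M) => ν x.1 * ((1 : ℝ) / (M : ℝ) ^ d)) n)
    {ν : T → ℝ} (hν : IsFKGMeasure ν) (K : ℕ) (g : Fin d → Fin (K + 1) → ℝ) (hg0 : ∀ i u, 0 ≤ g i u)
    (hg1 : ∀ i, ∑ u, g i u = 1) :
    SahiPositive (fun x : T × (Fin d → Fin (K + 1)) => ν x.1 * ∏ i, g i (x.2 i)) n := by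
  intro f hf hmono
  have hcont : Continuous fun v : Fin d → Fin (K + 1) → ℝ =>
      sahiE (fun x : T × (Fin d → Fin (K + 1)) => ν x.1 * ∏ i, v i (x.2 i)) n f :=
    (Literature.Probability.Percolation.BHK2006.continuous_sahiE n f).comp (continuous_paramGridProd ν)
  have hlim : Tendsto (fun M : ℕ => fun i u => (approx (g i) M u : ℝ) / M) atTop (𝓝 g) :=
    tendsto_pi_nhds.2 fun i => tendsto_pi_nhds.2 fun u => tendsto_approx_div (g i) (hg0 i) (hg1 i) u
  refine ge_of_tendsto ((hcont.tendsto g).comp hlim) ?_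
  filter_upwards [eventually_ge_atTop 1] with M hM
  exact sahiPositive_paramGridProd_rat hU hν (fun i => approx (g i) M) hM
    (fun i => sum_approx (g i) (hg0 i) (hg1 i) M) f hf hmono

variable (T) in
/-- **`P_T(d,n) ⟺ U_T(d,n)`**: the product layer with parameter `T` reduces to `ν ⊗ (uniform weight on [M]^d)`, `ν` FKG on
`T`, `M ≥ 1`. [this work] -/
theorem param_grid_iff_uniform [DecidableEq T] (d n : ℕ) :
    (∀ (K : ℕ) (ν : T → ℝ), IsFKGMeasure ν → ∀ (g : Fin d → Fin (K + 1) → ℝ), (∀ i u, 0 ≤ g i u) →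
      (∀ i, ∑ u, g i u = 1) → SahiPositive (fun x : T × (Fin d → Fin (K + 1)) => ν x.1 * ∏ i, g i (x.2 i)) n) ↔
    ∀ (ν : T → ℝ), IsFKGMeasure ν → ∀ M, 0 < M →
      SahiPositive (fun x : T × (Fin d → Fin M) => ν x.1 * ((1 : ℝ) / (M : ℝ) ^ d)) n := by
  constructor
  · intro hP ν hν M hM
    obtain ⟨K, rfl⟩ : ∃ K, M = K + 1 := Nat.exists_eq_succ_of_ne_zero hM.ne'
    have h := hP K ν hν (fun _ _ => (1 : ℝ) / (K + 1 : ℕ)) (fun _ _ => by positivity)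
      (fun _ => by rw [sum_const, card_univ, Fintype.card_fin, nsmul_eq_mul]; field_simp)
    have heq : (fun x : T × (Fin d → Fin (K + 1)) => ν x.1 * ∏ _i : Fin d, (1 : ℝ) / ((K + 1 : ℕ) : ℝ)) =
        fun x => ν x.1 * ((1 : ℝ) / ((K + 1 : ℕ) : ℝ) ^ d) := by
      funext x
      rw [prod_const, card_univ, Fintype.card_fin, one_div_pow]
    rw [heq] at h
    exact h
  · intro hU K ν hν g hg0 hg1
    exact sahiPositive_paramGridProd_of_uniform hU hν K g hg0 hg1

variable (T) in
/-- **`U_T(d,n) ⟺ W_T(d,n)`.** [this work] -/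
theorem param_fkg_iff_uniform [DecidableEq T] (d n : ℕ) :
    (∀ (b : ℕ) (μ : T × (Fin d → Fin (b + 1)) → ℝ), IsFKGMeasure μ → SahiPositive μ n) ↔
    ∀ (ν : T → ℝ), IsFKGMeasure ν → ∀ M, 0 < M →
      SahiPositive (fun x : T × (Fin d → Fin M) => ν x.1 * ((1 : ℝ) / (M : ℝ) ^ d)) n := by
  rw [← param_grid_iff_fkg, param_grid_iff_uniform]

end Param

/-! ## Sublattices (per order) -/

section Embedding

variable {L P : Type*} [DistribLattice L] [Fintype L] [DistribLattice P] [Fintype P] {n : ℕ}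

/-- **Sahi positivity at a fixed order passes to sublattices**: if every FKG probability weight on `P` is Sahi-positive
at order `n` and `e : L → P` is injective and preserves `⊓`, `⊔`, then every FKG probability weight on `L` is Sahi-positive
at order `n` (zero extension is FKG; pull back along the monotone retraction `p ↦ ⋁{x | e x ≤ p}`). [this work] -/
theorem sahiPositive_of_latticeEmbedding_order (e : L → P) (he : Function.Injective e)
    (hinf : ∀ x y, e (x ⊓ y) = e x ⊓ e y) (hsup : ∀ x y, e (x ⊔ y) = e x ⊔ e y)
    (hP : ∀ ν : P → ℝ, IsFKGMeasure ν → SahiPositive ν n) {μ : L → ℝ} (hμ : IsFKGMeasure μ) :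
    SahiPositive μ n := by
  classical
  have hL : Nonempty L := by
    by_contra h
    rw [not_nonempty_iff] at h
    exact one_ne_zero (hμ.sum_eq_one.symm.trans (Fintype.sum_empty _))
  letI : OrderBot L := Fintype.toOrderBot L
  have hle : ∀ x y, e x ≤ e y ↔ x ≤ y := by
    intro x y
    constructor
    · intro h
      have h1 : e (x ⊓ y) = e x := by rw [hinf]; exact inf_eq_left.2 h
      exact inf_eq_left.1 (he h1)
    · intro h
      have h1 : e x ⊓ e y = e x := by rw [← hinf, inf_eq_left.2 h]
      exact inf_eq_left.1 h1
  obtain ⟨R, hR⟩ : ∃ R : P → L, ∀ p, R p = (univ.filter fun x => e x ≤ p).sup id := ⟨_, fun p => rfl⟩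
  have hRmono : Monotone R := by
    intro p p' hpp'
    rw [hR, hR]
    refine Finset.sup_mono fun x hx => ?_
    rw [mem_filter] at hx ⊢
    exact ⟨hx.1, hx.2.trans hpp'⟩
  have hRE : ∀ x, R (e x) = x := by
    intro x
    rw [hR]
    refine le_antisymm (Finset.sup_le fun y hy => ?_) ?_
    · rw [mem_filter] at hy
      exact (hle y x).1 hy.2
    · exact Finset.le_sup (f := id) (by rw [mem_filter]; exact ⟨mem_univ _, le_rfl⟩)
  exact SahiCubeAllOrders.sahiPositive_of_pushWeight_of_retract hRmono hRE
    (hP _ (isFKGMeasure_pushWeight hμ he hinf hsup))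

end Embedding

end

end Summit.CriticalPhenomena.PercolationContinuityZ3.Theorems.SahiLayer
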